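import Mathlib
import HarnessLib

/-!
# Product mixing for global sets in the alternating group (Keevash–Lifshitz 2023)

Vocabulary and one named fact from P. Keevash, N. Lifshitz, *Sharp hypercontractivity for
symmetric groups and its applications*, arXiv:2307.15030 (bib key `KeevashLifshitz2023`), §1.2–1.3:

* `umvirate I J` — the `t`-umvirate `U_{I→J} = {σ ∈ S_n : σ ∘ I = J}` of two `t`-tuples
  `I J : Fin t → Fin n` (paper p. 4: "for `I, J ∈ [n]_t` we write `U_{I→J} = {σ ∈ S_n : σ ∘ I = J}` …
  Following Friedgut we call `U_{I→J}` a `t`-umvirate"; for injective `I, J` it is a coset of the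
  pointwise stabiliser of a `t`-set, for non-injective data it may be empty — harmless below, where
  only injective tuples are quantified);
* `IsGlobal r A` — Def. 1.6 for SETS: `A ⊆ S_n` is `r`-global iff its indicator is
  `(r, ‖1_A‖₂)`-global, i.e. for every `d` and all `I, J ∈ [n]_d`,
  `‖(1_A)_{I→J}‖₂ ≤ r^d ‖1_A‖₂`; squaring, `μ(A ∩ U_{I→J})/μ(U_{I→J}) ≤ r^{2d} μ(A)` ("restricting to
  any `t`-umvirate increases the density by a factor at most `r^{2t}`", p. 5), written with cleared
  denominators over `ℕ`-cardinalities cast to `ℝ`: `|A ∩ U_{I→J}| · n! ≤ r^{2d} · |A| · |U_{I→J}|`.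
  Normalisation is the paper's own (uniform measure on `S_n`, Def. 1.6 verbatim); for subsets of
  `A_n` it coincides with the `A_n`-normalised notion at all levels `d ≤ n - 2` and is marginally
  STRONGER at `d ≥ n - 1` (one-point umvirates), so assuming it asks no less than the paper does;
* `GlobalProductMixing` — **Theorem 1.14** (with Def. 1.13): "The alternating group `A_n` is
  `0.01`-mixing for `100`-global `e^{-cn^{1/3}}`-dense products, for some absolute constant `c > 0`",
  i.e. for `A, B, C ⊆ A_n` that are `100`-global of densities `≥ e^{-cn^{1/3}}` in `A_n`,
  `Pr_{a,b ∼ A_n}[a ∈ A, b ∈ B, ab ∈ C] ∈ (1 ± 0.01) μ(A)μ(B)μ(C)`; with `|A_n| = n!/2` this reads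
  `|#{(a,b) ∈ A × B : ab ∈ C} · (n!/2) − |A||B||C|| < 0.01 · |A||B||C|`.  Transcribed with a
  non-strict inequality and an extra `∃ n₀, ∀ n ≥ n₀` — both WEAKER than print.  A NAMED FACT
  (`def … : Prop`), not proved here: the proof is the paper's level-`d` inequality (Thm. 1.8), the
  spectral bound for global convolution operators (Thm. 1.9) and Thm. 4.1, i.e. sharp
  hypercontractivity in `S_n` — far outside Mathlib today.

Deliberately NOT here: the function version of globalness (`(r,γ)`-global `f`), the degree
decomposition `V_{=d}`, Thms. 1.8/1.9/1.12/1.15, and any "relative" globalness inside a point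
stabiliser (a route-side notion of `Summits/MatrixMultiplication`, not the paper's).
-/

namespace Literature.Combinatorics.Additive.KeevashLifshitz

open Finset

/-- The `t`-**umvirate** `U_{I→J} = {σ ∈ S_n : σ ∘ I = J}` of two `t`-tuples `I J : Fin t → Fin n`
(Keevash–Lifshitz, arXiv:2307.15030, p. 4, following Friedgut 2008; Ellis–Friedgut–Pilpel 2011).
For injective `I, J` it is a left coset of the pointwise stabiliser of `range I`; if exactly one of
`I, J` is injective it is empty. [cite: KeevashLifshitz2023, §1.2] -/
def umvirate {n t : ℕ} (I J : Fin t → Fin n) : Finset (Equiv.Perm (Fin n)) :=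
  univ.filter (fun σ => ∀ k, σ (I k) = J k)

/-- Membership in an umvirate, definitionally. [cite: KeevashLifshitz2023, §1.2] -/
theorem mem_umvirate {n t : ℕ} {I J : Fin t → Fin n} {σ : Equiv.Perm (Fin n)} :
    σ ∈ umvirate I J ↔ ∀ k, σ (I k) = J k := by
  simp [umvirate]

/-- **`r`-global set** (Keevash–Lifshitz, arXiv:2307.15030, **Def. 1.6**, for indicator functions,
`S_n`-normalised as printed): `A ⊆ S_n` is `r`-global iff for every `d` and all injective
`d`-tuples `I, J` ("`I, J ∈ [n]_d`"), restricting to the umvirate `U_{I→J}` increases the density of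
`A` by a factor at most `r^{2d}`: `μ(A ∩ U_{I→J}) / μ(U_{I→J}) ≤ r^{2d} · μ(A)`, written with cleared
denominators `|A ∩ U_{I→J}| · n! ≤ r^{2d} · |A| · |U_{I→J}|` (equivalent since `|U_{I→J}| > 0` for
injective data and `|S_n| = n!`). [cite: KeevashLifshitz2023, Def. 1.6] -/
def IsGlobal {n : ℕ} (r : ℝ) (A : Finset (Equiv.Perm (Fin n))) : Prop :=
  ∀ d : ℕ, ∀ I J : Fin d → Fin n, Function.Injective I → Function.Injective J →
    ((A ∩ umvirate I J).card : ℝ) * (n.factorial : ℝ) ≤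
      r ^ (2 * d) * (A.card : ℝ) * ((umvirate I J).card : ℝ)

/-- Sanity/non-vacuity: the whole group `S_n` is `r`-global for every `r ≥ 1` (restricting the
uniform set to an umvirate does not change its density). [cite: KeevashLifshitz2023, Def. 1.6] -/
theorem isGlobal_univ {n : ℕ} {r : ℝ} (hr : 1 ≤ r) :
    IsGlobal r (univ : Finset (Equiv.Perm (Fin n))) := by
  intro d I J _ _
  rw [univ_inter, card_univ, Fintype.card_perm, Fintype.card_fin]
  have h1 : (1 : ℝ) ≤ r ^ (2 * d) := one_le_pow₀ hr
  have h0 : (0 : ℝ) ≤ (n.factorial : ℝ) * ((umvirate I J).card : ℝ) := by positivity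
  nlinarith

/-- The empty set is `r`-global for every `r` (both sides vanish). [cite: KeevashLifshitz2023, Def. 1.6] -/
theorem isGlobal_empty {n : ℕ} (r : ℝ) : IsGlobal r (∅ : Finset (Equiv.Perm (Fin n))) := by
  intro d I J _ _
  simp

/-- **Product mixing for global dense subsets of `A_n`** — Keevash–Lifshitz, arXiv:2307.15030,
**Theorem 1.14** (with Def. 1.13, `ε`-mixing for products, and Def. 1.6, globalness): "The
alternating group `A_n` is `0.01`-mixing for `100`-global `e^{-cn^{1/3}}`-dense products, for some
absolute constant `c > 0`."  Unfolded: there is an absolute `c > 0` such that (for all large `n`)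
for all `A, B, C ⊆ A_n` (finite sets of EVEN permutations of `Fin n`) that are `100`-global and have
`|A|, |B|, |C| ≥ e^{-cn^{1/3}} · |A_n| = e^{-cn^{1/3}} · n!/2`, the number of pairs
`(a, b) ∈ A × B` with `a * b ∈ C` satisfies
`|#{(a,b)} · (n!/2) − |A||B||C|| ≤ 0.01 · |A||B||C|`
(print: `Pr_{a,b ∼ A_n}[a ∈ A, b ∈ B, ab ∈ C] ∈ (1 − 0.01, 1 + 0.01) · μ(A)μ(B)μ(C)`, an OPEN interval
and no `n₀` — this transcription is weaker on both counts).  NAMED FACT, not proved in the tree: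
the proof is the paper's sharp hypercontractive / level-`d` machinery (Thms. 1.8, 1.9, 4.1).
Sharpness of the density `e^{-Θ(n^{1/3})}` is the paper's §7.
[cite: KeevashLifshitz2023, Thm. 1.14] -/
def GlobalProductMixing : Prop :=
  ∃ c : ℝ, 0 < c ∧ ∃ n₀ : ℕ, ∀ n ≥ n₀, ∀ A B C : Finset (Equiv.Perm (Fin n)),
    (∀ σ ∈ A, Equiv.Perm.sign σ = 1) → (∀ σ ∈ B, Equiv.Perm.sign σ = 1) →
    (∀ σ ∈ C, Equiv.Perm.sign σ = 1) →
    IsGlobal 100 A → IsGlobal 100 B → IsGlobal 100 C →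
    Real.exp (-(c * (n : ℝ) ^ ((1 : ℝ) / 3))) * ((n.factorial : ℝ) / 2) ≤ (A.card : ℝ) →
    Real.exp (-(c * (n : ℝ) ^ ((1 : ℝ) / 3))) * ((n.factorial : ℝ) / 2) ≤ (B.card : ℝ) →
    Real.exp (-(c * (n : ℝ) ^ ((1 : ℝ) / 3))) * ((n.factorial : ℝ) / 2) ≤ (C.card : ℝ) →
    |(((A ×ˢ B).filter (fun ab => ab.1 * ab.2 ∈ C)).card : ℝ) * ((n.factorial : ℝ) / 2) -
        (A.card : ℝ) * (B.card : ℝ) * (C.card : ℝ)| ≤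
      (1 / 100) * ((A.card : ℝ) * (B.card : ℝ) * (C.card : ℝ))

/-- The LOWER half of `GlobalProductMixing` in the form used by density-increment arguments:
`0.99 · |A||B||C| / (n!/2) ≤ #{(a,b) ∈ A × B : ab ∈ C}`. [cite: KeevashLifshitz2023, Thm. 1.14] -/
theorem GlobalProductMixing.lower (h : GlobalProductMixing) :
    ∃ c : ℝ, 0 < c ∧ ∃ n₀ : ℕ, ∀ n ≥ n₀, ∀ A B C : Finset (Equiv.Perm (Fin n)),
    (∀ σ ∈ A, Equiv.Perm.sign σ = 1) → (∀ σ ∈ B, Equiv.Perm.sign σ = 1) →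
    (∀ σ ∈ C, Equiv.Perm.sign σ = 1) →
    IsGlobal 100 A → IsGlobal 100 B → IsGlobal 100 C →
    Real.exp (-(c * (n : ℝ) ^ ((1 : ℝ) / 3))) * ((n.factorial : ℝ) / 2) ≤ (A.card : ℝ) →
    Real.exp (-(c * (n : ℝ) ^ ((1 : ℝ) / 3))) * ((n.factorial : ℝ) / 2) ≤ (B.card : ℝ) →
    Real.exp (-(c * (n : ℝ) ^ ((1 : ℝ) / 3))) * ((n.factorial : ℝ) / 2) ≤ (C.card : ℝ) →
    0.99 * ((A.card : ℝ) * (B.card : ℝ) * (C.card : ℝ)) / ((n.factorial : ℝ) / 2) ≤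
      (((A ×ˢ B).filter (fun ab => ab.1 * ab.2 ∈ C)).card : ℝ) := by
  obtain ⟨c, hc, n₀, h⟩ := h
  refine ⟨c, hc, n₀, fun n hn A B C hA hB hC gA gB gC dA dB dC => ?_⟩
  have habs := h n hn A B C hA hB hC gA gB gC dA dB dC
  have hF : (0 : ℝ) < (n.factorial : ℝ) / 2 := by
    have : (0 : ℝ) < n.factorial := by exact_mod_cast n.factorial_pos
    linarith
  rw [div_le_iff₀ hF]
  have := (abs_le.1 habs).1
  nlinarith

end Literature.Combinatorics.Additive.KeevashLifshitz
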